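import Summits.NavierStokesRegularity.NavierStokesRegularity.Theses.MarginalReynoldsCreep
import HarnessLib

/-!
# Birth skeleton — crux `AmplificationHorizon` (stmt-NavierStokesRegularity-17672, route MarginalReynoldsCreep;
# piece X₁ of the typed split of `NoBreathing`)

Line `leray-window-uniformised`: X₁ asks for ONE similarity horizon `τ₀ > 0` serving every level
`M`.  Leray's local theory serves level `M` with the degenerate horizon `θ(M) ≈ cν/M` but, inside
that window, parabolic smoothing turns the Type-I(M) slice into a SCALE-INVARIANTLY SMOOTH slice
(velocity and gradient bounded in similarity units).  So the open content is exactly a uniform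
horizon from SMOOTH Type-I slices:

* `stub_lerayWindowSmoothing` — KNOWN (Leray 1934 §19 (3.8); Ożański–Pooley 2018 Thm 6.22 +
  Thm 6.15/Cor 6.16; Giga–Inui–Matsui 1999 §3 for the `L^∞` mild theory with the gradient bound
  `‖∇u(t₀+h)‖_∞ ≲ ‖u(t₀)‖_∞ (νh)^{-1/2}`; tree: `leray_strong_local_existence`,
  `serrin_weak_strong_uniqueness_holds`, `IsLerayHopfOn.isLerayHopfOn_translate_of_bound`): for
  `ν, M > 0` there are `ρ ∈ (0,1)`, `G`, `C₁` such that every maximal Leray–Hopf classical solution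
  with a Type-I(M) slice at `t₀ ∈ [0,T)` has coupling `≤ G` on the window `t₀ ≤ t`,
  `T - t ≥ ρ(T - t₀)`, and at the window's end `t₀⁺ = T - ρ(T - t₀)` the similarity-scaled
  gradient bound `(T - t₀⁺)‖∇u(t₀⁺, x)‖ ≤ C₁` (`ρ = max(1/2, 1 - cν/M)`, `G = 4M`, `C₁ ≈ M/ν`).
* `stub_smoothSliceHorizon` — OPEN CORE: for a non-Type-I maximal Clay solution there is ONE
  horizon `τ₀ > 0` such that for all levels `M` and gradient levels `C₁` the coupling stays
  `≤ G(M, C₁)` for log-time `τ₀` after every late smooth Type-I(M, C₁) slice.  This is X₁ with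
  the slice upgraded to a smooth one — the form in which compactness / stability arguments for
  Type-I data (Albritton–Barker 2019; Barker–Prange 2021) start; every local clock (L^∞,
  Lipschitz, BKM) still gives only `≈ ν/M`, `1/C₁`.
* `AmplificationHorizon_of` — PROVED: concatenate the Leray window `[t₀, t₀⁺]` (bound `G_L`) with
  the smooth-slice window of log-length `τ₀` from `t₀⁺` (bound `G₂` at levels
  `max(G_L,1), max(C₁,1)`); since `T - t₀⁺ ≤ T - t₀` the second window covers
  `T - t ≥ e^{-τ₀}(T - t₀)` beyond `t₀⁺`.
-/

noncomputable section

set_option linter.dupNamespace false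
set_option linter.unusedVariables false

namespace Summit.NavierStokesRegularity.NavierStokesRegularity.Cruxes.AmplificationHorizon.Birth

open MeasureTheory Set Function Filter Topology
open Literature.Analysis.FluidPDE
open scoped ENNReal NNReal

local notation "ℝ³" => EuclideanSpace ℝ (Fin 3)

/-- KNOWN — Leray's `L^∞` window after a Type-I(M) slice, with parabolic smoothing of the gradient
at the window's end (Leray 1934 §19 (3.8); Ożański–Pooley 2018 Thm 6.22, Thm 6.15, Cor 6.16;
Giga–Inui–Matsui 1999 §3). -/
theorem stub_lerayWindowSmoothing :
    ∀ ν M : ℝ, 0 < ν → 0 < M → ∃ ρ G C₁ : ℝ, 0 < ρ ∧ ρ < 1 ∧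
      ∀ (T : ℝ) (u : ℝ → ℝ³ → ℝ³) (p : ℝ → ℝ³ → ℝ), 0 < T →
        IsMaximalSmoothSolution ν 0 u p T → IsLerayHopfOn T ν 0 (u 0) u →
        ∀ t₀ : ℝ, 0 ≤ t₀ → t₀ < T → (∀ x, (T - t₀) * ‖u t₀ x‖ ^ 2 ≤ M) →
          (∀ t : ℝ, t₀ ≤ t → ρ * (T - t₀) ≤ T - t → ∀ x, (T - t) * ‖u t x‖ ^ 2 ≤ G) ∧
          (∀ x, (ρ * (T - t₀)) * ‖fderiv ℝ (u (T - ρ * (T - t₀))) x‖ ≤ C₁) := by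
  sorry

/-- OPEN CORE — a level-uniform horizon from SMOOTH Type-I slices (velocity level `M`, gradient
level `C₁` in similarity units), eventually along a non-Type-I maximal Clay solution. -/
theorem stub_smoothSliceHorizon :
    ∀ (ν T : ℝ), 0 < ν → 0 < T → ∀ (u : ℝ → ℝ³ → ℝ³) (p : ℝ → ℝ³ → ℝ),
      IsMaximalSmoothSolution ν 0 u p T → IsLerayHopfOn T ν 0 (u 0) u →
      HasRapidSpatialDecay (u 0) → ¬ IsTypeIBlowup u T →
      ∃ τ₀ : ℝ, 0 < τ₀ ∧ ∀ M C₁ : ℝ, 0 < M → 0 < C₁ → ∃ G : ℝ, ∀ᶠ t₀ in 𝓝[<] T,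
        (∀ x, (T - t₀) * ‖u t₀ x‖ ^ 2 ≤ M) → (∀ x, (T - t₀) * ‖fderiv ℝ (u t₀) x‖ ≤ C₁) →
          ∀ t : ℝ, t₀ ≤ t → Real.exp (-τ₀) * (T - t₀) ≤ T - t →
            ∀ x, (T - t) * ‖u t x‖ ^ 2 ≤ G := by
  sorry

/-- Filter bookkeeping: `∀ᶠ t in 𝓝[<] T` as a threshold. -/
theorem eventually_nhdsLT_iff {T : ℝ} {P : ℝ → Prop} :
    (∀ᶠ t in 𝓝[<] T, P t) ↔ ∃ a < T, ∀ t, a < t → t < T → P t := by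
  rw [(nhdsLT_basis T).eventually_iff]
  constructor
  · rintro ⟨a, ha, h⟩
    exact ⟨a, ha, fun t h1 h2 => h ⟨h1, h2⟩⟩
  · rintro ⟨a, ha, h⟩
    exact ⟨a, ha, fun t ht => h t ht.1 ht.2⟩

/-- **Skeleton theorem: `AmplificationHorizon` from the two registered stubs** (real proof:
concatenation of the Leray window with the smooth-slice window). -/
theorem AmplificationHorizon_of :
    Summit.NavierStokesRegularity.NavierStokesRegularity.Theses.MarginalReynoldsCreep.AmplificationHorizon := by
  intro ν T hν hT u p hmax hLH hdec hnI
  obtain ⟨τ₀, hτ₀, hor⟩ := stub_smoothSliceHorizon ν T hν hT u p hmax hLH hdec hnI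
  refine ⟨τ₀, hτ₀, fun M hM => ?_⟩
  obtain ⟨ρ, G₁, C₁, hρ0, hρ1, hL⟩ := stub_lerayWindowSmoothing ν M hν hM
  have hM' : 0 < max G₁ 1 := lt_max_of_lt_right one_pos
  have hC' : 0 < max C₁ 1 := lt_max_of_lt_right one_pos
  obtain ⟨G₂, hG₂⟩ := hor (max G₁ 1) (max C₁ 1) hM' hC'
  obtain ⟨a₂, ha₂, h2'⟩ := eventually_nhdsLT_iff.1 hG₂
  refine ⟨max G₁ G₂, eventually_nhdsLT_iff.2 ⟨max a₂ 0, max_lt ha₂ hT, ?_⟩⟩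
  intro t₀ hat₀ ht₀T hdip t ht₀t hwin x
  have ht₀0 : 0 ≤ t₀ := (le_max_right a₂ 0).trans hat₀.le
  have ha₂t₀ : a₂ < t₀ := lt_of_le_of_lt (le_max_left _ _) hat₀
  obtain ⟨hwinL, hgrad⟩ := hL T u p hT hmax hLH t₀ ht₀0 ht₀T hdip
  have hTt₀ : 0 < T - t₀ := sub_pos.2 ht₀T
  by_cases hc : ρ * (T - t₀) ≤ T - t
  · exact (hwinL t ht₀t hc x).trans (le_max_left _ _)
  · push Not at hc
    -- the end slice `t₁ = T - ρ (T - t₀)` of the Leray window is a smooth Type-I slice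
    have hρT : 0 < ρ * (T - t₀) := mul_pos hρ0 hTt₀
    have hρT' : ρ * (T - t₀) ≤ T - t₀ := by nlinarith
    have ht₀t₁ : t₀ ≤ T - ρ * (T - t₀) := by linarith
    have ht₁T : T - ρ * (T - t₀) < T := by linarith
    have hTt₁ : T - (T - ρ * (T - t₀)) = ρ * (T - t₀) := by ring
    have hdip₁ : ∀ y, (T - (T - ρ * (T - t₀))) * ‖u (T - ρ * (T - t₀)) y‖ ^ 2 ≤ max G₁ 1 :=
      fun y => (hwinL _ ht₀t₁ (le_of_eq hTt₁.symm) y).trans (le_max_left _ _)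
    have hgrad₁ : ∀ y, (T - (T - ρ * (T - t₀))) * ‖fderiv ℝ (u (T - ρ * (T - t₀))) y‖ ≤ max C₁ 1 :=
      fun y => by rw [hTt₁]; exact (hgrad y).trans (le_max_left _ _)
    have ha₂t₁ : a₂ < T - ρ * (T - t₀) := lt_of_lt_of_le ha₂t₀ ht₀t₁
    have ht₁t : T - ρ * (T - t₀) ≤ t := by linarith
    have hwin' : Real.exp (-τ₀) * (T - (T - ρ * (T - t₀))) ≤ T - t := by
      rw [hTt₁]
      have he : 0 < Real.exp (-τ₀) := Real.exp_pos _
      calc Real.exp (-τ₀) * (ρ * (T - t₀)) ≤ Real.exp (-τ₀) * (T - t₀) :=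
            mul_le_mul_of_nonneg_left hρT' he.le
        _ ≤ T - t := hwin
    exact (h2' _ ha₂t₁ ht₁T hdip₁ hgrad₁ t ht₁t hwin' x).trans (le_max_right _ _)

end Summit.NavierStokesRegularity.NavierStokesRegularity.Cruxes.AmplificationHorizon.Birth
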